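import Literature.Probability.LatticeModels.IntersectionSecondMoment
import Literature.Probability.LatticeModels.ImprovedTreeDiagramBound
import Literature.Probability.LatticeModels.RandomCurrents
import Literature.Probability.LatticeModels.IsingThermodynamics
import HarnessLib

/-!
# Objects of the line `dominant-shell-concentration` for the crux `RungOneAdjacentMerging`
(item stmt-CriticalPhenomena-11262; route decl
`Summit.CriticalPhenomena.Ising3DConformalLimit.Theses.EnergyNotSigmaSquared.RungOneAdjacentMerging`)

Route-posited objects (D-0016: the definitions a line posits live in a reviewed `…Defs` file, never
inside a proof file).  The line (checked skeleton
`Cruxes/RungOneAdjacentMerging/Lines/dominant-shell-concentration.lean`, lead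
`prover-line-stmt-CriticalPhenomena-11262-0`) bounds the probability that two independent sourced
double currents in the free box `Λ_n ⊂ ℤ³` at `β_c(3)`, tied at the ADJACENT nails `0 → x` and
`e₂ → x + e₂`, have disjoint clusters, by the second-moment (Chebyshev) inequality for a
pointwise-normalised weighted coincidence count on Messager–Miracle-Solé cone cells at windowed,
decay-separated dyadic scales carrying a divergent share of the critical bubble.

Contents (definitional bookkeeping only; every piece of mathematics is in the stub files
`Theorems/EnergyNotSigmaSquaredRungOneAdjacentMerging*.lean` that import this module):
* infinite volume (`d = 3`, `β = β_c(3)`): `Gc`, `e₂`, `axisG`, `Bub`, `dens`, `tstep`,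
  `InfVolWeights`, `HasWindow`, `share`, `HarvestData`;
* finite volume (any finite graph, uniform coupling): `fvMean`, `fvSecond`, `SecondMomentData`;
* the statements of the seven registered stubs and of the variance bound: `MeanOneChebyshev`,
  `BoxPassage`, `TowardCells`, `WindowRegular`, `ShareHarvest`, `HarvestInputs`, `AbstractHarvest`,
  `VarianceBound`, `Assembly`.

References: Aizenman–Duminil-Copin 2021 (arXiv:1912.07973) §4.2 Lemma 4.4, §6.2 (6.5), Remark 6.5,
Appendix A Prop. A.3 (one-point identity, two-step bound, second-moment method, cone);
Duminil-Copin–Panis 2025 (arXiv:2404.05700) Thm 1.8 and (1.11) (bubble divergence, gradient estimate);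
Messager–Miracle-Solé 1977.  The vocabulary is the tree's (`criticalTwoPoint`, `bubbleDiagram`,
`doubleCurrentMeasure`, `tracedConn`, `ecurrentSum`, `Current.twoStepBound`).
-/

noncomputable section

open MeasureTheory Filter Finset
open scoped BigOperators ENNReal symmDiff
open Literature.Probability.LatticeModels

namespace Summit.CriticalPhenomena.Ising3DConformalLimit.RungOneAdjacentMergingDominantShell

/-! ### Vocabulary of the line (infinite volume, `d = 3`, `β = β_c(3)`) -/

/-- The critical two-point function `G(u) = ⟨σ₀σ_u⟩⁺_{β_c(3)}` of `ℤ³` (`= ⟨·⟩^free` at `β_c`,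
`twoPointPlus_criticalBeta_eq_twoPointFree_holds`; `> 0`; `c‖u‖⁻² ≤ G(u) ≤ C‖u‖⁻¹`,
`criticalTwoPoint_bounds_holds`; `‖·‖` is the sup norm, `Site.norm_eq_supNorm`). [folklore] -/
abbrev Gc : Site 3 → ℝ := criticalTwoPoint 3

/-- The second nail `e₂ = (0,1,0)` (the crux's `Pi.single 1 1`). [folklore] -/
def e₂ : Site 3 := Pi.single 1 1

/-- The axis two-point function `g(m) = G(m e₁)` (antitone in `m` by Messager–Miracle-Solé; by MMS
`g(‖u‖₁) ≤ G(u) ≤ g(‖u‖_∞)`). [folklore] -/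
def axisG (m : ℕ) : ℝ := Gc (Pi.single 0 (m : ℤ))

/-- The truncated bubble `B(L) = Σ_{‖y‖_∞ ≤ L} G(y)²` (tree `bubbleDiagram`; `B(2^k) → ∞`,
Duminil-Copin–Panis 2025 Thm 1.8, tree `NNIsing.bubbleDiagram_criticalBeta_three_eq_top`). [cite: AizenmanDuminilCopinAnnals2021, arXiv:1912.07973 Thm 1.3, definition of B_L(β) (p. 6)] -/
def Bub (L : ℝ) : ℝ := bubbleDiagram (criticalTwoPoint 3) L

/-- The exact one-point density of the sourced system `0 → x` at `u`:
`P^{0x,∅}[u ∈ C(0)] = G(u)G(x-u)/G(x)` (tree `tsum_epairWeight_mul_indicator_mem_cluster`, in the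
infinite-volume limit). The system `e₂ → x+e₂` has density `dens x (u - e₂)`. [cite: AizenmanDuminilCopinAnnals2021, arXiv:1912.07973 §4.2, proof of Lemma 4.4 (first moment)] -/
def dens (x u : Site 3) : ℝ := Gc u * Gc (x - u) / Gc x

/-- The infinite-volume two-step bound of ADC21 Prop. A.3 for the system `0 → x` at the pair
`(u, v)`: `G(u)G(v-u)G(x-v) + G(v)G(u-v)G(x-u)` (tree `Current.twoStepBound`, normalised by `Z[∅]³`).
The system `e₂ → x+e₂` has `tstep x (u - e₂) (v - e₂)`. [cite: AizenmanDuminilCopinAnnals2021, arXiv:1912.07973 Appendix A.2, Proposition A.3] -/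
def tstep (x u v : Site 3) : ℝ := Gc u * Gc (v - u) * Gc (x - v) + Gc v * Gc (u - v) * Gc (x - u)

/-- INFINITE-VOLUME WEIGHTS at level `η` for the far point `x`: nonnegative weights `c` on a finite
set `U` whose weighted coincidence count has (normalised) second moment at most `1 + η` times the
squared mean — `Σ_{u,v} c c T₁T₂ ≤ (1+η)·G(x)²·(Σ_u c a a')²`, mean positive. [cite: AizenmanDuminilCopinAnnals2021, arXiv:1912.07973 §6.2 (6.5) (second-moment method)] -/
def InfVolWeights (η : ℝ) (x : Site 3) : Prop :=
  ∃ (U : Finset (Site 3)) (c : Site 3 → ℝ), (∀ u, 0 ≤ c u) ∧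
    0 < ∑ u ∈ U, c u * (dens x u * dens x (u - e₂)) ∧
    ∑ u ∈ U, ∑ v ∈ U, c u * c v * (tstep x u v * tstep x (u - e₂) (v - e₂)) ≤
      (1 + η) * Gc x ^ 2 * (∑ u ∈ U, c u * (dens x u * dens x (u - e₂))) ^ 2

/-- A doubling WINDOW of the axis two-point function around the dyadic scale `ℓ` (eight dyadic
scales, constant `A`): `g(2^{ℓ-4}) ≤ A·g(2^{ℓ+4})`. [folklore] -/
def HasWindow (A : ℝ) (ℓ : ℕ) : Prop := axisG (2 ^ (ℓ - 4)) ≤ A * axisG (2 ^ (ℓ + 4))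

/-- The (axis form of the) bubble SHARE of scale `ℓ`: `8^ℓ g(2^{ℓ+2})² / B(2^{ℓ+1})` — the inverse of
the diagonal (same-scale) clumping ratio of a cone cell at scale `ℓ`. [folklore] -/
def share (ℓ : ℕ) : ℝ := 8 ^ ℓ * axisG (2 ^ (ℓ + 2)) ^ 2 / Bub (2 ^ (ℓ + 1))

/-- `share ℓ ≥ 0` (a quotient of a square by a sum of squares). [folklore] -/
theorem share_nonneg : ∀ ℓ : ℕ, 0 ≤ share ℓ := fun _ =>
  div_nonneg (mul_nonneg (pow_nonneg (by norm_num) _) (sq_nonneg _)) (bubbleDiagram_nonneg _ _)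

/-- `B(L) ≥ 0`. [folklore] -/
theorem Bub_nonneg (L : ℝ) : 0 ≤ Bub L := bubbleDiagram_nonneg _ _

/-! ### Vocabulary of the line (finite volume: any finite graph, uniform coupling `β`) -/

section FiniteVolume

variable {V : Type} [Fintype V] [DecidableEq V] (G : SimpleGraph V) [DecidableRel G.Adj]

/-- Un-normalised weighted MEAN of the coincidence count of the two systems `o → y`, `a → y'`:
`Σ_u c(u) · Z[ou]Z[uy] · Z[au]Z[uy']` (`= Z[oy]Z[ay']Z[∅]² · E[N]`, one-point identity twice). [cite: AizenmanDuminilCopinAnnals2021, arXiv:1912.07973 §4.2, proof of Lemma 4.4 (first moment of |𝓜|)] -/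
def fvMean (β : ℝ) (o a y y' : V) (c : V → ℝ≥0∞) : ℝ≥0∞ :=
  ∑ u, c u * ((ecurrentSum (fun _ : ↥G.edgeFinset => β) ({o} ∆ {u}) *
      ecurrentSum (fun _ : ↥G.edgeFinset => β) ({u} ∆ {y})) *
    (ecurrentSum (fun _ : ↥G.edgeFinset => β) ({a} ∆ {u}) *
      ecurrentSum (fun _ : ↥G.edgeFinset => β) ({u} ∆ {y'})))

/-- Un-normalised weighted SECOND-MOMENT BOUND: `Σ_{u,v} c(u)c(v) B_{oy}(u,v) B_{ay'}(u,v)` with ADC21's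
two-step bounds (`≥ Z[oy]Z[ay']Z[∅]⁴ · E[N²]`, Prop. A.3 once per system). [cite: AizenmanDuminilCopinAnnals2021, arXiv:1912.07973 §4.2, proof of Lemma 4.4 (second moment of |𝓜|)] -/
def fvSecond (β : ℝ) (o a y y' : V) (c : V → ℝ≥0∞) : ℝ≥0∞ :=
  ∑ u, ∑ v, c u * c v *
    (Current.twoStepBound (fun _ : ↥G.edgeFinset => β) o y u v *
      Current.twoStepBound (fun _ : ↥G.edgeFinset => β) a y' u v)

/-- FINITE-VOLUME SECOND-MOMENT DATA at level `θ`: weights whose mean is finite and nonzero and whose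
(normalised) second-moment bound is at most `(1+θ)·mean²`:
`Z[oy]·Z[ay']·fvSecond ≤ (1+θ)·fvMean²`. [folklore] -/
def SecondMomentData (β θ : ℝ) (o a y y' : V) : Prop :=
  ∃ c : V → ℝ≥0∞, fvMean G β o a y y' c ≠ 0 ∧ fvMean G β o a y y' c ≠ ∞ ∧
    ecurrentSum (fun _ : ↥G.edgeFinset => β) ({o} ∆ {y}) *
        ecurrentSum (fun _ : ↥G.edgeFinset => β) ({a} ∆ {y'}) * fvSecond G β o a y y' c ≤
      ENNReal.ofReal (1 + θ) * fvMean G β o a y y' c ^ 2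

end FiniteVolume

/-! ### The STATEMENTS of the registered stubs of the line (named `Prop`s; the skeleton's
`Registered.stub_*` aliases and `RungOneAdjacentMerging_of` consume them by these names) -/

/-- Statement of STUB 1 (mean-one Chebyshev for the duplicated two-centre system, any finite graph). -/
def MeanOneChebyshev : Prop :=
  ∀ (V : Type) [Fintype V] [DecidableEq V] (G : SimpleGraph V) [DecidableRel G.Adj] (β : ℝ), 0 ≤ β →
    ∀ θ : ℝ, 0 ≤ θ → ∀ o a y y' : V, SecondMomentData G β θ o a y y' →
      ((doubleCurrentMeasure G β ({o} ∆ {y}) ∅).prod (doubleCurrentMeasure G β ({a} ∆ {y'}) ∅)).real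
          {pq | ∀ u : V, ¬ (pq.1 ∈ tracedConn G o u ∧ pq.2 ∈ tracedConn G a u)} ≤ θ

/-- Statement of STUB 2 (box passage `Λ_n ↑ ℤ³` of the weights). -/
def BoxPassage : Prop :=
  ∀ (x : Site 3) (η θ : ℝ), 0 < η → η < θ → InfVolWeights η x →
    ∃ n₀ : ℕ, ∀ n : ℕ, n₀ ≤ n → ∀ o a y y' : ↥(box 3 n),
      (o : Site 3) = 0 → (a : Site 3) = Pi.single 1 1 → (y : Site 3) = x →
      (y' : Site 3) = x + Pi.single 1 1 →
        SecondMomentData ((zdGraph 3).comap (Subtype.val : ↥(box 3 n) → Site 3))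
          (criticalBeta 3) θ o a y y'

/-- Statement of STUB 3 (doubly-toward Messager–Miracle-Solé cone cells). -/
def TowardCells : Prop :=
  ∃ c₀ : ℝ, 0 < c₀ ∧ ∀ k : ℕ, 4 ≤ k → ∀ x : Site 3, (2 : ℝ) ^ (k + 4) ≤ ‖x‖ →
    ∃ U : Finset (Site 3), c₀ * 8 ^ k ≤ (U.card : ℝ) ∧ ∀ u ∈ U,
      (2 : ℝ) ^ (k - 1) ≤ ‖u‖ ∧ ‖u‖ ≤ (2 : ℝ) ^ k ∧
      Gc x ≤ Gc (x - u) ∧ Gc x ≤ Gc (x - (u - e₂)) ∧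
      axisG (2 ^ (k + 2)) ≤ Gc u ∧ axisG (2 ^ (k + 2)) ≤ Gc (u - e₂)

/-- Statement of STUB 4 (one-sided P2 from a doubling window, `d = 3`). -/
def WindowRegular : Prop :=
  ∀ A : ℝ, 1 ≤ A → ∃ C : ℝ, 0 ≤ C ∧ ∀ ℓ : ℕ, 4 ≤ ℓ → HasWindow A ℓ →
    ∀ v w : Site 3, (2 : ℝ) ^ (ℓ - 2) ≤ ‖v‖ → ‖v‖ ≤ (2 : ℝ) ^ (ℓ + 1) → 16 * ‖w‖ ≤ (2 : ℝ) ^ ℓ →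
      Gc (v - w) ≤ (1 + C * ‖w‖ / 2 ^ ℓ) * Gc v

/-- **Abstract harvest data**: the four tree inputs of the share harvest, stated
for two real sequences `a` (the dyadic axis values `g(2^j)`) and `B` (the dyadic bubbles `B(2^k)`):
`a > 0` antitone and `→ 0` (Messager–Miracle-Solé + infrared bound), DYADIC LOG-CONVEXITY
`a_{j+1}³ ≤ a_j² a_{j+2}` (the ramp constraint `θ_{j+1} ≤ 2θ_j`, from axis log-convexity
`g(n)² ≤ g(n-1)g(n+1)`, tree `TwoPointLogConvex.axisForm_sq_le` at `m*(β_c) = 0`), `B > 0`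
non-decreasing and `→ ∞` (Duminil-Copin–Panis 2025 Thm 1.8, tree
`NNIsing.bubbleDiagram_criticalBeta_three_eq_top`), and the MMS SHELL SANDWICH
`7·8^k a_{k+2}² ≤ B_k - B_{k-1} ≤ 19·8^k a_{k-1}²` (`k ≥ 1`; the dyadic shell
`2^{k-1} < ‖z‖_∞ ≤ 2^k` has between `7·8^k` and `19·8^k` points, on it
`g(2^{k+2}) ≤ G(z) ≤ g(2^{k-1})` by `twoPointPlus_le_of_mul_supNorm_le` /
`twoPointPlus_le_axis_of_mem_sphere`). -/
structure HarvestData (a B : ℕ → ℝ) : Prop where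
  a_pos : ∀ j, 0 < a j
  a_anti : Antitone a
  a_tendsto : Tendsto a atTop (nhds 0)
  a_logConvex : ∀ j, a (j + 1) ^ 3 ≤ a j ^ 2 * a (j + 2)
  B_pos : 0 < B 0
  B_mono : Monotone B
  B_tendsto : Tendsto B atTop atTop
  shell_lower : ∀ k, 1 ≤ k → 7 * 8 ^ k * a (k + 2) ^ 2 ≤ B k - B (k - 1)
  shell_upper : ∀ k, 1 ≤ k → B k - B (k - 1) ≤ 19 * 8 ^ k * a (k - 1) ^ 2

/-- Statement of STUB 5a (the harvest inputs hold for the critical axis profile and bubble). -/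
def HarvestInputs : Prop :=
  HarvestData (fun j => axisG (2 ^ j)) (fun k => Bub (2 ^ k))

/-- Statement of STUB 5b (the abstract harvest: windowed, τ-separated scales with unbounded share,
for ANY pair of sequences obeying `HarvestData`). -/
def AbstractHarvest : Prop :=
  ∀ a B : ℕ → ℝ, HarvestData a B →
    ∃ A : ℝ, 1 ≤ A ∧ ∀ τ : ℝ, 0 < τ → ∀ (k₀ : ℕ) (M : ℝ), ∃ 𝒦 : Finset ℕ,
      (∀ k ∈ 𝒦, k₀ ≤ k ∧ a (k - 4) ≤ A * a (k + 4)) ∧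
      (∀ k ∈ 𝒦, ∀ ℓ ∈ 𝒦, k < ℓ → a (ℓ - 2) ≤ τ * a (k + 2) ∧ (2 : ℝ) ^ (k + 1) ≤ τ * 2 ^ ℓ) ∧
      M ≤ ∑ k ∈ 𝒦, (8 : ℝ) ^ k * a (k + 2) ^ 2 / B (k + 1)

/-- SHARE HARVEST (harvest of bubble share along windowed, decay-separated scales; derived in the
skeleton from STUBS 5a + 5b by unfolding). -/
def ShareHarvest : Prop :=
  ∃ A : ℝ, 1 ≤ A ∧ ∀ τ : ℝ, 0 < τ → ∀ (k₀ : ℕ) (M : ℝ), ∃ 𝒦 : Finset ℕ,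
    (∀ k ∈ 𝒦, k₀ ≤ k ∧ HasWindow A k) ∧
    (∀ k ∈ 𝒦, ∀ ℓ ∈ 𝒦, k < ℓ →
      axisG (2 ^ (ℓ - 2)) ≤ τ * axisG (2 ^ (k + 2)) ∧ (2 : ℝ) ^ (k + 1) ≤ τ * 2 ^ ℓ) ∧
    M ≤ ∑ k ∈ 𝒦, share k

/-- The infinite-volume VARIANCE BOUND (conclusion of STUB 6): for every `η > 0`, beyond some radius
every far point `x` admits infinite-volume weights at level `η`. -/
def VarianceBound : Prop :=
  ∀ η : ℝ, 0 < η → ∃ R : ℝ, ∀ x : Site 3, R ≤ ‖x‖ → InfVolWeights η x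

/-- Statement of STUB 6 (assembly of the variance bound from cells, windows and the harvest). -/
def Assembly : Prop := TowardCells → WindowRegular → ShareHarvest → VarianceBound

end Summit.CriticalPhenomena.Ising3DConformalLimit.RungOneAdjacentMergingDominantShell

end
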